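import Summits.AtomisticToContinuum.Crystallization.Theorems.OverbindingBudgetAffineCoreDescentA

/-!
# NODE g100 «CoreDescent», part B (lens-4) — PACKING: the whole wild leaf `W(ρ₁)` is charged to the θ-layer and the MID sites,
# `W(ρ₁) ⟸ ShearLayer ∧ MID(1/10⁴)` for EVERY radius `ρ₁ ≥ 0`, seams PROVED (0 sorry); the swap returns to its record tolerance `10⁻³`

Part A (`…CoreDescentA`) reduced the two IDEA-NEEDED wild cells of record to `CoreShear ∧ CoarseMid` (`CoarseMid = MID(1/10⁴)`, engine form
`ShearLayer`).  This part removes the other two wild cells («MildShear», «HaloWild») and the tolerance dial `θ₁` altogether.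

EXTREMAL OBSERVATION.  A wild run-interior site `j` (not `(ρ₁, 1/10⁴, 10⁻³)`-affinely deep) HAS A WITNESS: a site `w` within `ρ₁·nn_j` that is not
`(1/10⁴, 10⁻³)`-affinely registered.  That witness is, by excluded middle, one of: not `64`-deep (REBATED), `64`-deep but not `(12, 1/10⁴, 1/25)`-affinely
deep (an affine-MID site at `1/10⁴`: PRICED by `CoarseMid`), or `64`-deep with a `(1/10⁴, 1/25)`-smooth `12`-ball — and then, being itself strained beyond
`10⁻³`, it is a `ShearSite` (PRICED by `ShearLayer`) — or off-window (REBATED).  In-window sites are `σ₁`-separated and the witness lies within `ρ₁σ₂`, so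
each witness serves at most `27(2ρ₁σ₂ + σ₁)³/σ₁³` wild sites (`card_le_of_cube`, the packing of g74's `notDeepCount_depth_le`, here for an arbitrary
witness relation: `natCard_le_mul_of_witness`).  Hence (`censusW_of_le_mul`: a census of `A` against `D` prices every `R ≤ K·(A + D + #off)` at rate `c/(K+1)`):

  `W_W(ρ₁) ⟸ ShearLayer_W ∧ MID_W(1/10⁴)` at every window `[σ₁, σ₂]`, `0 < σ₁ ≤ σ₂` (`balancedWildRunGapW_of_shearLayerW_midW`), so
  `W(ρ₁) ⟸ ShearLayer ∧ CoarseMid` (`wildRunGap_of_shearLayer_coarseMid`; `WildRun`, `WildRunWide`, `WildRunWide30` = ρ₁ = 12, 24, 30), and with the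
  tree's cut `W(ρ₁) ⟺ MildShear ∧ HaloWild ∧ StrainCore ∧ RoughCore` ALL FOUR wild cells at every `(ρ₁, L ≥ 0, θ₁)` follow (`wildCells_of_shearLayer_coarseMid`).

CONSEQUENCE FOR THE (2c) RECORD.  The swap needs no enlarged tolerance: with `W(30)` discharged by `ShearLayer ∧ CoarseMid`, the tree seam
`balancedRunInteriorGapW_of_swapFlatW` at the RECORD tolerance `θ₀ = 10⁻³` and radius `30` (compressed leaf = the landed `compressedRun_record` by radius
monotonicity) gives

  `InterfaceDominance ⟸ SW♭₃₀ ∧ ShearLayer ∧ CoarseMid ∧ ThinFault` (`interfaceDominance_of_swapWide30`), `SW♭₃₀ := TameStackSwapGainFlat 64 30 (1/10⁴) (1/1000) …`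
  («StackSwapGainFlatWide30»; the radius-24 twin `interfaceDominance_of_swapWide24` through the tree's `interfaceDominance_of_swapFlatWide_thinFault`),
  and RDEF through `rdef_of_ceg_shape_corePacking_record` (cone `rdef_of_ceg_shape_roughCut_record` BY NAME).

Reading (census SHEARBOX-56, critic r1860 (F)): at `θ₀ = 10⁻³` the bilayer swap's gain `G = 2|J₂(a)| − λ_op(a)θ² − tail(30)` is `≥ +8.4·10⁻⁵ > 0` on the
whole scale window `a ∈ [0.888, 1.04]` (binding at the tensile end through `J₂`), whereas every `θ₁ > 10⁻³` proposed for «MildShear» fails on the compressed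
third.  This part makes the question moot: «MildShear(30, 64, θ₁)» and «HaloWild(30, 64, θ₁)» are COROLLARIES of `ShearLayer ∧ CoarseMid` for every `θ₁`
(mildly sheared smooth matter is θ-layer matter or rigid; a halo site is charged to its wildness witness), so no per-box tolerance `θ₁,B`, no rider, and no
radius-12 far-field question (27V-H) remains on the cone.  The (2c) line after this node: ONE certified-type competitor leaf `SW♭₃₀` at the record literals,
`ThinFault`, and the two smooth pieces `ShearLayer` [INSTRUMENTABLE «STRAINBOX» · ATTACKABLE-L] and `CoarseMid = MID(1/10⁴)` [IDEA-NEEDED].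
No instance, no notation, no new literal beyond part A's; every tree statement BY NAME.
-/

namespace Summit.AtomisticToContinuum.Crystallization.Theorems.OverbindingBudgetAffineCoreDescent

open scoped BigOperators Classical
open Literature.MathematicalPhysics.StatisticalMechanics
open Literature.Geometry.DiscreteGeometry (IsChargeFree nearestDist nearestDist_nonneg nearestDist_le_dist)
open Summit.AtomisticToContinuum.Crystallization.Theorems.OverbindingBudgetMisfitRegistration (Framed Reg DeepReg)
open Summit.AtomisticToContinuum.Crystallization.Theorems.OverbindingBudgetMisfitWindowStatements (InWindow offCount)
open Summit.AtomisticToContinuum.Crystallization.Theorems.OverbindingBudgetMisfitCensusStatements (card_le_of_cube)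
open Summit.AtomisticToContinuum.Crystallization.Theorems.OverbindingBudgetBalancedCensusStatements
open Summit.AtomisticToContinuum.Crystallization.Theorems.OverbindingBudgetAffineLadder
open Summit.AtomisticToContinuum.Crystallization.Theorems.OverbindingBudgetAffineMesoCut
open Summit.AtomisticToContinuum.Crystallization.Theorems.OverbindingBudgetAffinePhaseCut
open Summit.AtomisticToContinuum.Crystallization.Theorems.OverbindingBudgetAffineCushionCut
open Summit.AtomisticToContinuum.Crystallization.Theorems.OverbindingBudgetAffineTwinCut
open Summit.AtomisticToContinuum.Crystallization.Theorems.OverbindingBudgetAffineRunCut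
open Summit.AtomisticToContinuum.Crystallization.Theorems.OverbindingBudgetAffineCompressedCut
open Summit.AtomisticToContinuum.Crystallization.Theorems.OverbindingBudgetAffineRunCutFlat
open Summit.AtomisticToContinuum.Crystallization.Theorems.OverbindingBudgetAffineWildCut

variable {N : ℕ}

/-! ## §6  Census algebra: domination by a real multiple of the PRICED count -/

/-- **Census domination by a real multiple**: if `R ≤ K·(A + D + #off)` pointwise on injective configurations (`K ≥ 0`), a census of `A` against `D`
is a census of `R` against `D` (rate `c/(K+1)`, constant `max C 0 + c`). [this file · formal bookkeeping] -/
theorem censusW_of_le_mul {A R D : ∀ {N : ℕ}, (Fin N → EuclideanSpace ℝ (Fin 3)) → ℕ} {σ₁ σ₂ K : ℝ} (hK : 0 ≤ K)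
    (hR : ∀ {N : ℕ} (y : Fin N → EuclideanSpace ℝ (Fin 3)), Function.Injective y → (R y : ℝ) ≤ K * (A y + D y + offCount σ₁ σ₂ y))
    (h : CensusW A D σ₁ σ₂) : CensusW R D σ₁ σ₂ := by
  obtain ⟨c, C, hc, h⟩ := h
  set P : ℝ := max C 0 with hP
  have hP0 : 0 ≤ P := le_max_right _ _
  have hCP : C ≤ P := le_max_left _ _
  have hK1 : 0 < K + 1 := by linarith
  refine ⟨c / (K + 1), P + c, div_pos hc hK1, fun N y hy => ?_⟩
  obtain ⟨u, hu, e⟩ := h N y hy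
  refine ⟨u, hu, ?_⟩
  have hRy := hR y hy
  have n1 : (0 : ℝ) ≤ A y := Nat.cast_nonneg _
  have n3 : (0 : ℝ) ≤ D y := Nat.cast_nonneg _
  have n5 : (0 : ℝ) ≤ offCount σ₁ σ₂ y := Nat.cast_nonneg _
  have n6 : (0 : ℝ) ≤ (N : ℝ) ^ (2 / 3 : ℝ) := Real.rpow_nonneg (Nat.cast_nonneg _) _
  have g1 : 0 ≤ dilGain y + shGain u y := add_nonneg (dilGain_nonneg y) (shGain_nonneg _ y)
  have e' : (N : ℝ) * (⨅ Q : PeriodicConfiguration 3, Q.energyPerParticle lennardJones) + c * (A y : ℝ)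
      - P * (D y : ℝ) - P * (offCount σ₁ σ₂ y : ℝ) - P * (N : ℝ) ^ (2 / 3 : ℝ) - P * (dilGain y + shGain u y)
      ≤ interactionEnergy lennardJones y := by
    linarith [mul_le_mul_of_nonneg_right hCP n3, mul_le_mul_of_nonneg_right hCP n5, mul_le_mul_of_nonneg_right hCP n6,
      mul_le_mul_of_nonneg_right hCP g1]
  have hc' : 0 ≤ c / (K + 1) := (div_pos hc hK1).le
  have hcK : c / (K + 1) * K ≤ c := by
    rw [div_mul_eq_mul_div, div_le_iff₀ hK1]
    nlinarith
  have hX : (0 : ℝ) ≤ A y + D y + offCount σ₁ σ₂ y := by linarith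
  have step : c / (K + 1) * (R y : ℝ) ≤ c * (A y + D y + offCount σ₁ σ₂ y) := by
    have h1 := mul_le_mul_of_nonneg_left hRy hc'
    have h2 : c / (K + 1) * (K * (A y + D y + offCount σ₁ σ₂ y)) = (c / (K + 1) * K) * (A y + D y + offCount σ₁ σ₂ y) := by ring
    have h3 := mul_le_mul_of_nonneg_right hcK hX
    linarith
  linarith [mul_nonneg hc.le n6, mul_nonneg hc.le g1]

/-! ## §7  Packing for an arbitrary witness relation (g74's `notDeepCount_depth_le`, generalised) -/

/-- **Witness packing**: if every IN-WINDOW site with property `P` has a site with property `Q` within distance `R₀`, then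
`#P ≤ 27(2R₀ + σ₁)³/σ₁³ · #Q + #off` — in-window sites are `σ₁`-separated (`nearestDist_le_dist`), so a ball of radius `R₀` holds at most
`27(2R₀+σ₁)³/σ₁³` of them (`card_le_of_cube`). [this file · formal bookkeeping] -/
theorem natCard_le_mul_of_witness {σ₁ σ₂ R₀ : ℝ} (hσ : 0 < σ₁) (hR₀ : 0 ≤ R₀) {y : Fin N → EuclideanSpace ℝ (Fin 3)}
    (hy : Function.Injective y) {P Q : Fin N → Prop} (hPQ : ∀ i, InWindow σ₁ σ₂ y i → P i → ∃ j, Q j ∧ dist (y i) (y j) ≤ R₀) :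
    (Nat.card {i // P i} : ℝ) ≤ 27 / σ₁ ^ 3 * (2 * R₀ + σ₁) ^ 3 * Nat.card {j // Q j} + offCount σ₁ σ₂ y := by
  classical
  set K : ℝ := 27 / σ₁ ^ 3 * (2 * R₀ + σ₁) ^ 3 with hK
  set S : Finset (Fin N) := Finset.univ.filter (fun i => InWindow σ₁ σ₂ y i ∧ P i) with hS
  set B : Finset (Fin N) := Finset.univ.filter (fun j => Q j) with hB
  set Of : Finset (Fin N) := Finset.univ.filter (fun i => ¬ InWindow σ₁ σ₂ y i) with hOf
  have hPc : Nat.card {i // P i} = (Finset.univ.filter fun i => P i).card := by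
    rw [Nat.card_eq_fintype_card, Fintype.card_subtype]
  have hBc : Nat.card {j // Q j} = B.card := by
    rw [Nat.card_eq_fintype_card, Fintype.card_subtype]
  have hOfc : offCount σ₁ σ₂ y = Of.card := by
    rw [offCount, Nat.card_eq_fintype_card, Fintype.card_subtype]
  have hsplit : (Finset.univ.filter fun i => P i).card ≤ S.card + Of.card := by
    calc (Finset.univ.filter fun i => P i).card ≤ (S ∪ Of).card := by
          apply Finset.card_le_card
          intro i hi
          rw [Finset.mem_filter] at hi
          rw [Finset.mem_union, Finset.mem_filter, Finset.mem_filter]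
          by_cases hw : InWindow σ₁ σ₂ y i
          · exact Or.inl ⟨hi.1, hw, hi.2⟩
          · exact Or.inr ⟨hi.1, hw⟩
      _ ≤ S.card + Of.card := Finset.card_union_le _ _
  set T : Fin N → Finset (Fin N) := fun j => S.filter (fun i => dist (y i) (y j) ≤ R₀) with hT
  have hcover : S ⊆ B.biUnion T := by
    intro i hi
    have hi' := (Finset.mem_filter.1 hi).2
    obtain ⟨j, hj, hd⟩ := hPQ i hi'.1 hi'.2
    rw [Finset.mem_biUnion]
    exact ⟨j, Finset.mem_filter.2 ⟨Finset.mem_univ _, hj⟩, Finset.mem_filter.2 ⟨hi, hd⟩⟩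
  have hfib : ∀ j : Fin N, ((T j).card : ℝ) ≤ K := by
    intro j
    have hcardim : ((T j).image y).card = (T j).card := Finset.card_image_of_injective _ hy
    set o : EuclideanSpace ℝ (Fin 3) := WithLp.toLp 2 (fun k : Fin 3 => (y j) k - R₀) with ho
    have hok : ∀ k : Fin 3, o k = (y j) k - R₀ := fun k => rfl
    have hmem : ∀ z ∈ (T j).image y, ∀ k : Fin 3, o k ≤ z k ∧ z k < o k + (2 * R₀ + σ₁) := by
      intro z hz k
      rw [Finset.mem_image] at hz
      obtain ⟨i, hi, rfl⟩ := hz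
      have hd : dist (y i) (y j) ≤ R₀ := (Finset.mem_filter.1 hi).2
      have hk : |(y i) k - (y j) k| ≤ dist (y i) (y j) := by
        rw [← Real.dist_eq]
        exact PiLp.dist_apply_le (y i) (y j) k
      have habs := abs_le.1 (hk.trans hd)
      rw [hok]
      constructor <;> linarith [habs.1, habs.2]
    have hsep : ∀ z ∈ (T j).image y, ∀ w ∈ (T j).image y, z ≠ w → σ₁ ≤ dist z w := by
      intro z hz w hw hzw
      rw [Finset.mem_image] at hz hw
      obtain ⟨i, hi, rfl⟩ := hz
      obtain ⟨i', hi', rfl⟩ := hw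
      have hii : i' ≠ i := fun h => hzw (by rw [h])
      have hwin : InWindow σ₁ σ₂ y i := ((Finset.mem_filter.1 (Finset.mem_filter.1 hi).1).2).1
      exact hwin.1.trans (nearestDist_le_dist y hii)
    have h := card_le_of_cube (F := (T j).image y) (o := o) hσ (by linarith) hmem hsep
    rw [hcardim] at h
    rw [hK]
    exact h
  have h1 : S.card ≤ (B.biUnion T).card := Finset.card_le_card hcover
  have h2 : (B.biUnion T).card ≤ ∑ j ∈ B, (T j).card := Finset.card_biUnion_le
  have h3 : (∑ j ∈ B, ((T j).card : ℝ)) ≤ ∑ j ∈ B, K := Finset.sum_le_sum (fun j _ => hfib j)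
  rw [Finset.sum_const, nsmul_eq_mul] at h3
  have h12 : (S.card : ℝ) ≤ ∑ j ∈ B, ((T j).card : ℝ) := by exact_mod_cast h1.trans h2
  have hSK : (S.card : ℝ) ≤ K * B.card := by
    calc (S.card : ℝ) ≤ B.card * K := h12.trans h3
      _ = K * B.card := by ring
  have hsplit' : (Nat.card {i // P i} : ℝ) ≤ S.card + Of.card := by rw [hPc]; exact_mod_cast hsplit
  rw [hBc, hOfc]
  linarith

/-! ## §8  The wildness witness and its classification -/

/-- `WildWitness σ₁ σ₂ y w` — the four fates of a wildness witness: a `ShearSite` (PRICED by `ShearLayer`), an affine-MID site at `1/10⁴`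
(PRICED by `CoarseMid`), not `64`-deep (REBATED), or off-window (REBATED). -/
def WildWitness (σ₁ σ₂ : ℝ) (y : Fin N → EuclideanSpace ℝ (Fin 3)) (w : Fin N) : Prop :=
  ShearSite y w ∨ (DeepReg 64 (3 / 50) (1 / 450) y w ∧ ¬ AffDeepReg 12 (1 / 10 ^ 4) (1 / 25) (1 / 450) y w) ∨
    ¬ DeepReg 64 (3 / 50) (1 / 450) y w ∨ ¬ InWindow σ₁ σ₂ y w

/-- **E-loc for wild sites**: an in-window wild site has a `WildWitness` within `ρ₁ σ₂`. [this file] -/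
theorem exists_wildWitness_of_wildSite {ρ₁ σ₁ σ₂ : ℝ} (hρ : 0 ≤ ρ₁) {y : Fin N → EuclideanSpace ℝ (Fin 3)} {j : Fin N}
    (hw : InWindow σ₁ σ₂ y j) (hj : WildSite ρ₁ y j) : ∃ w, WildWitness σ₁ σ₂ y w ∧ dist (y j) (y w) ≤ ρ₁ * σ₂ := by
  have hW := hj.2
  unfold AffDeepReg at hW
  push Not at hW
  obtain ⟨w, hdw, hnw⟩ := hW
  have hdj : dist (y j) (y w) ≤ ρ₁ * σ₂ := by
    rw [dist_comm]
    exact hdw.trans (mul_le_mul_of_nonneg_left hw.2 hρ)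
  refine ⟨w, ?_, hdj⟩
  by_cases hwin : InWindow σ₁ σ₂ y w
  swap
  · exact Or.inr (Or.inr (Or.inr hwin))
  by_cases hD : DeepReg 64 (3 / 50) (1 / 450) y w
  swap
  · exact Or.inr (Or.inr (Or.inl hD))
  by_cases hA : AffDeepReg 12 (1 / 10 ^ 4) (1 / 25) (1 / 450) y w
  swap
  · exact Or.inr (Or.inl ⟨hD, hA⟩)
  refine Or.inl ⟨hD, hA, fun h => hnw (h w ?_)⟩
  rw [dist_self]
  exact mul_nonneg (by norm_num) (nearestDist_nonneg y w)

/-- `#WildWitness ≤ #ShearSite + #affMid(64, 12, 1/10⁴, 1/25) + #{not 64-deep} + #off`. [formal bookkeeping] -/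
theorem wildWitnessCount_le (σ₁ σ₂ : ℝ) (y : Fin N → EuclideanSpace ℝ (Fin 3)) :
    Nat.card {w // WildWitness σ₁ σ₂ y w} ≤ shearLayerCount y + affMidCount 64 12 (1 / 10 ^ 4) (1 / 25) (3 / 50) (1 / 450) y
      + notDeepCount 64 (3 / 50) (1 / 450) y + offCount σ₁ σ₂ y := by
  have h1 : Nat.card {w // WildWitness σ₁ σ₂ y w} ≤ Nat.card {w // ShearSite y w}
      + Nat.card {w // (DeepReg 64 (3 / 50) (1 / 450) y w ∧ ¬ AffDeepReg 12 (1 / 10 ^ 4) (1 / 25) (1 / 450) y w) ∨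
          ¬ DeepReg 64 (3 / 50) (1 / 450) y w ∨ ¬ InWindow σ₁ σ₂ y w} := natCard_le_add_of_imp fun _ h => h
  have h2 : Nat.card {w // (DeepReg 64 (3 / 50) (1 / 450) y w ∧ ¬ AffDeepReg 12 (1 / 10 ^ 4) (1 / 25) (1 / 450) y w) ∨
          ¬ DeepReg 64 (3 / 50) (1 / 450) y w ∨ ¬ InWindow σ₁ σ₂ y w}
      ≤ Nat.card {w // DeepReg 64 (3 / 50) (1 / 450) y w ∧ ¬ AffDeepReg 12 (1 / 10 ^ 4) (1 / 25) (1 / 450) y w}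
        + Nat.card {w // ¬ DeepReg 64 (3 / 50) (1 / 450) y w ∨ ¬ InWindow σ₁ σ₂ y w} := natCard_le_add_of_imp fun _ h => h
  have h3 : Nat.card {w // ¬ DeepReg 64 (3 / 50) (1 / 450) y w ∨ ¬ InWindow σ₁ σ₂ y w}
      ≤ Nat.card {w // ¬ DeepReg 64 (3 / 50) (1 / 450) y w} + Nat.card {w // ¬ InWindow σ₁ σ₂ y w} := natCard_le_add_of_imp fun _ h => h
  unfold shearLayerCount affMidCount notDeepCount offCount
  omega

/-- **The wild leaf's count is packed onto the witnesses**: for `0 ≤ ρ₁`, `0 < σ₁ ≤ σ₂`, on injective configurations,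
`#wild(ρ₁) ≤ 27(2ρ₁σ₂ + σ₁)³/σ₁³ · (#ShearSite + #affMid(1/10⁴) + #{not 64-deep} + #off) + #off`. [this file] -/
theorem wildRunCount_le_packing {ρ₁ σ₁ σ₂ : ℝ} (hρ : 0 ≤ ρ₁) (hσ : 0 < σ₁) (hσσ : σ₁ ≤ σ₂) {y : Fin N → EuclideanSpace ℝ (Fin 3)}
    (hy : Function.Injective y) :
    (wildRunCount 64 ρ₁ (1 / 10 ^ 4) (1 / 1000) (3 / 50) (1 / 450) 12 2 y : ℝ)
      ≤ 27 / σ₁ ^ 3 * (2 * (ρ₁ * σ₂) + σ₁) ^ 3 * ((shearLayerCount y + affMidCount 64 12 (1 / 10 ^ 4) (1 / 25) (3 / 50) (1 / 450) y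
          + notDeepCount 64 (3 / 50) (1 / 450) y + offCount σ₁ σ₂ y : ℕ) : ℝ) + offCount σ₁ σ₂ y := by
  have hP := natCard_le_mul_of_witness (σ₂ := σ₂) hσ (mul_nonneg hρ (hσ.le.trans hσσ)) hy (P := fun j => WildSite ρ₁ y j)
    (Q := fun w => WildWitness σ₁ σ₂ y w) (fun i hi hPi => exists_wildWitness_of_wildSite hρ hi hPi)
  have hQ : (Nat.card {w // WildWitness σ₁ σ₂ y w} : ℝ) ≤ ((shearLayerCount y + affMidCount 64 12 (1 / 10 ^ 4) (1 / 25) (3 / 50) (1 / 450) y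
      + notDeepCount 64 (3 / 50) (1 / 450) y + offCount σ₁ σ₂ y : ℕ) : ℝ) := by exact_mod_cast wildWitnessCount_le σ₁ σ₂ y
  have hb : 0 ≤ 2 * (ρ₁ * σ₂) + σ₁ := by nlinarith [mul_nonneg hρ (hσ.le.trans hσσ)]
  have hK0 : 0 ≤ 27 / σ₁ ^ 3 * (2 * (ρ₁ * σ₂) + σ₁) ^ 3 := mul_nonneg (div_nonneg (by norm_num) (pow_nonneg hσ.le 3)) (pow_nonneg hb 3)
  rw [wildRunCount_eq]
  exact hP.trans (by nlinarith [mul_le_mul_of_nonneg_left hQ hK0])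

/-! ## §9  THE PACKING SEAM: `W(ρ₁) ⟸ ShearLayer ∧ MID(1/10⁴)` -/

/-- **`W_W(ρ₁) ⟸ ShearLayer_W ∧ MID_W(1/10⁴)`** (one window `[σ₁, σ₂]`, `0 < σ₁ ≤ σ₂`, any `ρ₁ ≥ 0`): glue the two censuses (`censusW_glue`, the
θ-layer's MID walls absorbed), then pack the wild count onto the witnesses (§8, `censusW_of_le_mul`). [this file] -/
theorem balancedWildRunGapW_of_shearLayerW_midW {ρ₁ σ₁ σ₂ : ℝ} (hρ : 0 ≤ ρ₁) (hσ : 0 < σ₁) (hσσ : σ₁ ≤ σ₂) (hS : ShearLayerW σ₁ σ₂)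
    (hM : BalancedAffMidGapW 64 12 (1 / 10 ^ 4) (1 / 25) (3 / 50) (1 / 450) σ₁ σ₂) :
    BalancedWildRunGapW 64 ρ₁ (1 / 10 ^ 4) (1 / 1000) (3 / 50) (1 / 450) 12 2 σ₁ σ₂ := by
  have hG : CensusW (fun y => shearLayerCount y + affMidCount 64 12 (1 / 10 ^ 4) (1 / 25) (3 / 50) (1 / 450) y)
      (fun y => notDeepCount 64 (3 / 50) (1 / 450) y) σ₁ σ₂ :=
    censusW_glue (R := fun y => shearLayerCount y + affMidCount 64 12 (1 / 10 ^ 4) (1 / 25) (3 / 50) (1 / 450) y)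
      (A := fun y => shearLayerCount y) (B := fun y => affMidCount 64 12 (1 / 10 ^ 4) (1 / 25) (3 / 50) (1 / 450) y)
      (D₁ := fun y => notDeepCount 64 (3 / 50) (1 / 450) y + affMidCount 64 12 (1 / 10 ^ 4) (1 / 25) (3 / 50) (1 / 450) y)
      (D := fun y => notDeepCount 64 (3 / 50) (1 / 450) y) (fun _ => le_rfl) (fun _ => le_rfl) hS (balancedAffMidGapW_iff_censusW.1 hM)
  set K : ℝ := 27 / σ₁ ^ 3 * (2 * (ρ₁ * σ₂) + σ₁) ^ 3 with hK
  have hb : 0 ≤ 2 * (ρ₁ * σ₂) + σ₁ := by nlinarith [mul_nonneg hρ (hσ.le.trans hσσ)]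
  have hK0 : 0 ≤ K := by rw [hK]; exact mul_nonneg (div_nonneg (by norm_num) (pow_nonneg hσ.le 3)) (pow_nonneg hb 3)
  refine balancedWildRunGapW_iff_censusW.2 (censusW_of_le_mul (K := K + 1) (by linarith) (fun y hy => ?_) hG)
  have h := wildRunCount_le_packing hρ hσ hσσ hy
  rw [← hK] at h
  have n1 : (0 : ℝ) ≤ shearLayerCount y := Nat.cast_nonneg _
  have n2 : (0 : ℝ) ≤ affMidCount 64 12 (1 / 10 ^ 4) (1 / 25) (3 / 50) (1 / 450) y := Nat.cast_nonneg _
  have n3 : (0 : ℝ) ≤ notDeepCount 64 (3 / 50) (1 / 450) y := Nat.cast_nonneg _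
  have n4 : (0 : ℝ) ≤ offCount σ₁ σ₂ y := Nat.cast_nonneg _
  push_cast at h ⊢
  nlinarith [mul_nonneg hK0 n1, mul_nonneg hK0 n2, mul_nonneg hK0 n3, mul_nonneg hK0 n4]

/-- **`W(ρ₁) ⟸ ShearLayer ∧ CoarseMid`** for every radius `ρ₁ ≥ 0` (tame: windows `[δ, 2]`). [this file] -/
theorem wildRunGap_of_shearLayer_coarseMid {ρ₁ : ℝ} (hρ : 0 ≤ ρ₁) (hS : ShearLayer) (hM : CoarseMid) :
    TameBalancedWildRunGap 64 ρ₁ (1 / 10 ^ 4) (1 / 1000) (3 / 50) (1 / 450) 12 2 :=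
  fun δ hδ hδ2 => balancedWildRunGapW_of_shearLayerW_midW hρ hδ hδ2 (hS δ hδ hδ2) (hM δ hδ hδ2)

/-- **`WildRunWide30 ⟸ ShearLayer ∧ CoarseMid`** (the wild leaf of record, census v55 R55). [this file] -/
theorem wildRunWide30_of_shearLayer_coarseMid (hS : ShearLayer) (hM : CoarseMid) : WildRunWide30 :=
  wildRunGap_of_shearLayer_coarseMid (by norm_num) hS hM

/-- `WildRunWide ⟸ ShearLayer ∧ CoarseMid` (ρ₁ = 24). [this file] -/
theorem wildRunWide_of_shearLayer_coarseMid (hS : ShearLayer) (hM : CoarseMid) : WildRunWide :=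
  wildRunGap_of_shearLayer_coarseMid (by norm_num) hS hM

/-- `WildRun ⟸ ShearLayer ∧ CoarseMid` (ρ₁ = 12, the (2c) record literal). [this file] -/
theorem wildRun_of_shearLayer_coarseMid (hS : ShearLayer) (hM : CoarseMid) : WildRun :=
  wildRunGap_of_shearLayer_coarseMid (by norm_num) hS hM

/-- **ALL FOUR WILD CELLS at every `(ρ₁ ≥ 0, L ≥ 0, θ₁)` ⟸ ShearLayer ∧ CoarseMid** — in particular «MildShear 30 64 θ₁» and «HaloWild 30 64 θ₁» for
every tolerance `θ₁`: no enlarged swap tolerance and no radius-12 far field are needed for them (tree cut `tameBalancedWildRunGap_iff_cells`). [this file] -/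
theorem wildCells_of_shearLayer_coarseMid {ρ₁ L : ℝ} (hρ : 0 ≤ ρ₁) (hL : 0 ≤ L) (θ₁ : ℝ) (hS : ShearLayer) (hM : CoarseMid) :
    MildShear ρ₁ L θ₁ ∧ HaloWild ρ₁ L θ₁ ∧ StrainCore ρ₁ L θ₁ ∧ RoughCore ρ₁ L θ₁ :=
  (tameBalancedWildRunGap_iff_cells hL).1 (wildRunGap_of_shearLayer_coarseMid hρ hS hM)

/-- One-piece form: `W(ρ₁) ⟸ FlexMid` (`FlexMid ⟺ ShearLayer ∧ CoarseMid`, part A). [this file] -/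
theorem wildRunGap_of_flexMid {ρ₁ : ℝ} (hρ : 0 ≤ ρ₁) (h : FlexMid) :
    TameBalancedWildRunGap 64 ρ₁ (1 / 10 ^ 4) (1 / 1000) (3 / 50) (1 / 450) 12 2 :=
  wildRunGap_of_shearLayer_coarseMid hρ (flexMid_iff_shearLayer_coarseMid.1 h).1 (flexMid_iff_shearLayer_coarseMid.1 h).2

/-! ## §10  The (2c) record at the swap's RECORD tolerance `10⁻³` -/

/-- **`StackSwapGainFlatWide30`** «SW♭₃₀» — the flat bilayer-swap competitor of the (2c) line at radius `30` and the RECORD tolerance `θ₀ = 10⁻³`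
(all other literals of record).  [tree family `TameStackSwapGainFlat` · kind: statement (competitor) · INSTRUMENTABLE / certified-type: census SHEARBOX-56
§2 row `θ₁ = 1/1000`: `min G = +8.4·10⁻⁵ > 0` over `a ∈ [0.888, 1.04]` · the ONLY competitor leaf of the line after this node] -/
def StackSwapGainFlatWide30 : Prop :=
  TameStackSwapGainFlat 64 30 (1 / 10 ^ 4) (1 / 1000) (17 / 50) (17 / 20) (3 / 50) (1 / 450) 12 2

/-- The compressed run leaf at radius `30` HOLDS (landed `compressedRun_record`, radius monotonicity `balancedCompressedRunGapW_of_radius_le`). [tree, BY NAME] -/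
theorem compressedRunWide30_record : TameBalancedCompressedRunGap 64 30 (1 / 10 ^ 4) (1 / 1000) (17 / 20) (3 / 50) (1 / 450) 12 2 :=
  fun δ hδ hδ2 => balancedCompressedRunGapW_of_radius_le (by norm_num)
    (OverbindingBudgetAffineCompressedCutInner.compressedRun_record δ hδ hδ2)

/-- **`RunInterior ⟸ SW♭₃₀ ∧ ShearLayer ∧ CoarseMid`** (tree seam `balancedRunInteriorGapW_of_swapFlatW` at the record tolerance). [this file] -/
theorem runInterior_of_swapWide30 (hT : StackSwapGainFlatWide30) (hS : ShearLayer) (hM : CoarseMid) : RunInterior :=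
  fun δ hδ hδ2 => balancedRunInteriorGapW_of_swapFlatW hδ hδ2 (hT δ hδ hδ2) (compressedRunWide30_record δ hδ hδ2)
    (wildRunWide30_of_shearLayer_coarseMid hS hM δ hδ hδ2)

/-- **THE RECORD SEAM: `InterfaceDominance ⟸ SW♭₃₀ ∧ ShearLayer ∧ CoarseMid ∧ ThinFault`.** [this file] -/
theorem interfaceDominance_of_swapWide30 (hT : StackSwapGainFlatWide30) (hS : ShearLayer) (hM : CoarseMid) (hF : ThinFault) :
    InterfaceDominance :=
  interfaceDominance_iff_runInterior_thinFault.2 ⟨runInterior_of_swapWide30 hT hS hM, hF⟩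

/-- Radius-24 twin: `InterfaceDominance ⟸ SW♭₂₄ ∧ ShearLayer ∧ CoarseMid ∧ ThinFault` (tree `interfaceDominance_of_swapFlatWide_thinFault`). [this file] -/
theorem interfaceDominance_of_swapWide24 (hT : StackSwapGainFlatWide) (hS : ShearLayer) (hM : CoarseMid) (hF : ThinFault) : InterfaceDominance :=
  interfaceDominance_of_swapFlatWide_thinFault hT (wildRunWide_of_shearLayer_coarseMid hS hM) hF

/-- One-piece form of the record seam: `InterfaceDominance ⟸ SW♭₃₀ ∧ FlexMid ∧ ThinFault`. [this file] -/
theorem interfaceDominance_of_swapWide30_flexMid (hT : StackSwapGainFlatWide30) (h : FlexMid) (hF : ThinFault) : InterfaceDominance :=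
  interfaceDominance_of_swapWide30 hT (flexMid_iff_shearLayer_coarseMid.1 h).1 (flexMid_iff_shearLayer_coarseMid.1 h).2 hF

/-- The g99/g100-A instance is a COROLLARY: its six hypotheses at `(30, 1/400, 64)` shrink to four, the swap at `10⁻³`. [this file] -/
theorem interfaceDominance_of_coreDescent_theta0 (hT : StackSwapGainFlatWide30) (hS : ShearLayer) (hM : CoarseMid) (hF : ThinFault) :
    CompressedMild 30 (1 / 1000) ∧ HaloWild 30 64 (1 / 400) ∧ CoreShear 30 64 (1 / 400) ∧ InterfaceDominance :=
  ⟨fun δ hδ hδ2 => compressedMildW_of_wild (by norm_num) (wildRunWide30_of_shearLayer_coarseMid hS hM δ hδ hδ2),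
    (wildCells_of_shearLayer_coarseMid (by norm_num) (by norm_num) (1 / 400) hS hM).2.1, coreShear_of_shearLayer 30 (1 / 400) hS,
    interfaceDominance_of_swapWide30 hT hS hM hF⟩

/-- **RDEF of record through the packing node** (slot-3 cone `rdef_of_ceg_shape_roughCut_record` BY NAME; its `InterfaceDominance` leaf from
`SW♭₃₀ ∧ ShearLayer ∧ CoarseMid ∧ ThinFault`). [this file] -/
theorem rdef_of_ceg_shape_corePacking_record
    (hCEG : Summit.AtomisticToContinuum.Crystallization.Theses.PricedLinkCensus.ChargedEnergyGap)
    (hSh : OverbindingBudgetTwoShellShape.TwoShellShape (1 / 100) (3 / 50) (1 / 450))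
    (hQH : TameBalancedHexRoughGap 64 12 (1 / 10 ^ 5) (1 / 25) (3 / 50) (1 / 450) 12) (hQ : RoughCubic)
    (hT : StackSwapGainFlatWide30) (hS : ShearLayer) (hM : CoarseMid) (hF : ThinFault)
    (hK : ∃ μ₁ μR : ℝ, 0 < μ₁ ∧ 0 < μR ∧ OverbindingBudgetAffineNearCluster.PureMarginStabilityAt (3 / 2000) μ₁ μR 4)
    (hA : AffineChartStraightening)
    (hE : OverbindingBudgetAffineNearCluster.NearLightSkeletonEquilibrium (3 / 2000) 4 6 (1 / 1000) 12 (1 / 25) (1 / 2000) 4 6 320 12)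
    (hCF : OverbindingBudgetAffineNearCluster.NearPricedCoreFloor (3 / 2000) 4 6 (1 / 1000) 12 (1 / 25) (1 / 2000) (1 / (4 * 10 ^ 7) / 4) 4 6 12)
    (hSF : OverbindingBudgetAffineNearCluster.NearPricedShellFloor (3 / 2000) 4 6 (1 / 1000) 12 (1 / 25) (1 / 2000) (1 / (4 * 10 ^ 7) / 4) 4 6 12)
    (hV : OverbindingBudgetAffineNearCluster.ForceContentVisible (3 / 2000) 4 6 (1 / 1000) 12 (1 / 25) (1 / 2000) 4 6)
    (hN : OverbindingBudgetAffineNearCluster.NearSecondOrderFloor (3 / 2000) 4 6 (1 / 1000) 12 (1 / 25) (1 / 2000) (1 / (4 * 10 ^ 7)))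
    (hFA : OverbindingBudgetAffineLocalisation.FarAggregatePricing 12 (1 / 25) (1 / 2000) (1 / (2 * 10 ^ 7)))
    (hFR : FineNonAffinity 12 (1 / 10 ^ 5) (1 / 25))
    (hTT : OverbindingBudgetGradedBareness.CleanlessExcessT) (hRR : OverbindingBudgetCoherentCut.CoherentResidual 10) :
    Summit.AtomisticToContinuum.Crystallization.Theses.OverbindingBudget.RobustDefectLimitWindows :=
  rdef_of_ceg_shape_roughCut_record hCEG hSh hQH hQ (interfaceDominance_of_swapWide30 hT hS hM hF) hK hA hE hCF hSF hV hN hFA hFR hTT hRR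

end Summit.AtomisticToContinuum.Crystallization.Theorems.OverbindingBudgetAffineCoreDescent
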